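import Summits.Ventures.GridStability.Lyapunov.WSCC9LffNonUniformData
import Summits.Ventures.GridStability.Lyapunov.LffLevelNonempty
import HarnessLib

/-!
# GridStability/Lyapunov/WSCC9LffNonUniform — LFF-P1-NU: the CLOSED-FORM Vu–Turitsyn certificate of the LOSSLESS 9-bus
# variant WITH THE PRINTED NON-UNIFORM DAMPING is a member of the family on Pai's machine-reference space; hypothesis-free
# bridge from the typed model (the region / level / synchronisation sentences: `WSCC9LffNonUniformRoa.lean`)

Cell `gridfusion` (LADDER-GRIDFUSION), LFF lane, lead rulings R-LFFNU / R-LFFNU-SF (2026-08-27T04:12:32Z / 05:33:46Z: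
«closed-form member of the LFF family for WSCC9~lossless with the PRINTED non-uniform D_i on Pai's machine-reference
space … level sentence of #12's shape … kernel by decide, no producer»). Seat gridfusion-lyap-1 (g4); namespace
`Summit.Ventures.GridStability.Lyapunov.WSCC9LffNU`; data half = `WSCC9LffNonUniformData.lean` (object `data`, system `sys`,
the closed form `Q = [[M, hΛ⁻¹TᵀÑ⁻¹],[hÑ⁻¹TΛ⁻¹, hÑ⁻¹]]`, `K = w`, `H = hw`, `h = 1/20`, `Ñ = TD⁻¹Tᵀ`, `ε = 1/11000`, and its
kernel facts). LABEL OF EVERY MENTION: «synthetic lossless VARIANT of the printed 9-bus (post-fault-B network, transfer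
conductances dropped, block-C equilibrium, lossless redispatch) with the PRINTED NON-UNIFORM damping `D_i/M_i = 1/10, 1/5,
3/10` — a PIPELINE sentence, not a 9-bus sentence»; tokens MV-2L synthetic + MV-RD + MV-SPD + MV-h12 and NO MV-λ (the first
LFF certificate of the cell without the uniform-damping assumption).
WHAT IS PROVED HERE. `cert : Certificate sys` — membership in lit-6's family [cite: VuTuritsyn2016, §III eq. (QKH)]
(`Qᵀ = Q`, `Q ⪰ ε1`, `K ≥ 0`, `H > 0`, the full `11 × 11` LMI by reindexed integer Gram certificates; the faces hold EXACTLY,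
`Rq_eq_zero`). `field_eq` / `hasDerivWithinAt_state` — HYPOTHESIS-FREE BRIDGE: the undirected presentation `sys` has the
same vector field as model-1's directed `data.lurieSystem` (`θ = 0`, `Y = B`, antisymmetry of the line nonlinearity
`Gfun`, symmetry of `C`), so along every solution of the typed classical model `data.toModel` the machine-reference state
`(ω | σ)` solves `sys` (model-1's chain rule `RecastData.hasDerivWithinAt_lurieState`, p493501). The region, explicit
level, synchronisation and non-emptiness sentences: `WSCC9LffNonUniformRoa.lean`.
THREE COLUMNS. CERTIFIED: these sentences for MODEL M′ as LABEL. VALIDATED: nothing (no SDP, no solver; the triple is a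
closed form evaluated in exact arithmetic). No sentence of this file says that the WSCC 9-bus system or any grid is
stable. Definitions: real casts, `Gfun`, `cert` (bookkeeping); no named fact; standard axioms.
-/

noncomputable section

open Set Filter Topology Real Matrix Finset
open Literature.Computation.Certificates
open Literature.MathematicalPhysics.PowerSystems
open Literature.MathematicalPhysics.PowerSystems.LyapunovFunctionFamily
open Literature.MathematicalPhysics.PowerSystems.ClassicalModel.LosslessSystem (vtGap)
open Summit.Ventures.GridStability.Models
open Summit.Ventures.GridStability.Lyapunov.RelativeLff

namespace Summit.Ventures.GridStability.Lyapunov.WSCC9LffNU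

/-! ### Real casts of the data -/

/-- `Q` over `ℝ`. -/
def QR : Matrix (Fin 3 ⊕ Fin 2) (Fin 3 ⊕ Fin 2) ℝ := Qq.map (Rat.cast : ℚ → ℝ)

/-- `K` over `ℝ`. -/
def KR : RecastData.LffPair 2 → ℝ := fun k => (Kq k : ℝ)

/-- `H` over `ℝ`. -/
def HR : RecastData.LffPair 2 → ℝ := fun k => (Hq k : ℝ)

/-- `ε` over `ℝ`. -/
def eps : ℝ := (epsQ : ℝ)

/-! ### Cast plumbing (`ℚ → ℝ`, entrywise) -/

/-- `(M·N) ↦ ℝ` = product of the casts (plumbing). -/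
private theorem map_mul' {m n o : Type*} [Fintype n] (M : Matrix m n ℚ) (N : Matrix n o ℚ) :
    (M * N).map (Rat.cast : ℚ → ℝ) = M.map (Rat.cast : ℚ → ℝ) * N.map (Rat.cast : ℚ → ℝ) :=
  Matrix.map_mul (f := Rat.castHom ℝ)

/-- `(M+N) ↦ ℝ` = sum of the casts (plumbing). -/
private theorem map_add' {m n : Type*} (M N : Matrix m n ℚ) :
    (M + N).map (Rat.cast : ℚ → ℝ) = M.map (Rat.cast : ℚ → ℝ) + N.map (Rat.cast : ℚ → ℝ) := by
  ext i j; simp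

/-- `(M−N) ↦ ℝ` = difference of the casts (plumbing). -/
private theorem map_sub' {m n : Type*} (M N : Matrix m n ℚ) :
    (M - N).map (Rat.cast : ℚ → ℝ) = M.map (Rat.cast : ℚ → ℝ) - N.map (Rat.cast : ℚ → ℝ) := by
  ext i j; simp

/-- `(−M) ↦ ℝ` = minus the cast (plumbing). -/
private theorem map_neg' {m n : Type*} (M : Matrix m n ℚ) :
    (-M).map (Rat.cast : ℚ → ℝ) = -M.map (Rat.cast : ℚ → ℝ) := by
  ext i j; simp

/-- Transpose commutes with the cast (plumbing). -/
private theorem map_transpose' {m n : Type*} (M : Matrix m n ℚ) :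
    Mᵀ.map (Rat.cast : ℚ → ℝ) = (M.map (Rat.cast : ℚ → ℝ))ᵀ := rfl

/-- `diag(d) ↦ ℝ = diag(d ↦ ℝ)` (plumbing). -/
private theorem map_diagonal' {n : Type*} [DecidableEq n] (d : n → ℚ) :
    (Matrix.diagonal d).map (Rat.cast : ℚ → ℝ) = Matrix.diagonal (fun i => (d i : ℝ)) :=
  Matrix.diagonal_map Rat.cast_zero

/-- `(−2·M) ↦ ℝ = −2·(M ↦ ℝ)` (plumbing). -/
private theorem map_smul_two' {m n : Type*} (M : Matrix m n ℚ) :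
    ((-(2 : ℚ)) • M).map (Rat.cast : ℚ → ℝ) = (-(2 : ℝ)) • M.map (Rat.cast : ℚ → ℝ) := by
  ext i j; simp

/-- Block matrices commute with the cast (plumbing). -/
private theorem map_fromBlocks' {l m n o : Type*} (A : Matrix n l ℚ) (B : Matrix n m ℚ) (C : Matrix o l ℚ)
    (D : Matrix o m ℚ) :
    (Matrix.fromBlocks A B C D).map (Rat.cast : ℚ → ℝ)
      = Matrix.fromBlocks (A.map Rat.cast) (B.map Rat.cast) (C.map Rat.cast) (D.map Rat.cast) :=
  Matrix.fromBlocks_map A B C D _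

/-! ### The system matrices are the casts of their ℚ-mirrors -/

/-- `sys.A = Aq` (cast). -/
theorem sys_A : sys.A = Aq.map (Rat.cast : ℚ → ℝ) := by
  ext i j
  rcases i with i | a <;> rcases j with j | b
  · by_cases h : i = j
    · subst h; simp [sys, System.machineReference, Aq, lamq, ClassicalSwing.toLitNode_M]; rfl
    · simp [sys, System.machineReference, Aq, lamq, h]
  · simp [sys, System.machineReference, Aq]
  · simp only [sys, System.machineReference, Aq, Tq, InternalNode.refT, Matrix.fromBlocks_apply₂₁,
      Matrix.map_apply, Matrix.of_apply]
    split_ifs <;> norm_num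
  · simp [sys, System.machineReference, Aq]

/-- `sys.B = Bq` (cast). -/
theorem sys_B : sys.B = Bq.map (Rat.cast : ℚ → ℝ) := by
  ext i k
  rcases i with i | a
  · simp only [sys, System.machineReference, Bq, Matrix.fromRows_apply_inl, Matrix.map_apply, Bω, Bωq,
      RecastData.lffWo, RecastData.lffW]
    split_ifs <;> push_cast <;> ring
  · simp [sys, System.machineReference, Bq]

/-- `sys.C = Cq` (cast). -/
theorem sys_C : sys.C = Cq.map (Rat.cast : ℚ → ℝ) := by
  ext k j
  rcases j with j | b
  · simp [sys, System.machineReference, Cq]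
  · simp only [sys, System.machineReference, Cq, Matrix.fromCols_apply_inr, Matrix.map_apply, RecastData.lffEo,
      RecastData.lffE, Eq']
    split_ifs <;> norm_num

/-! ### The certificate fields -/

/-- `Qᵀ = Q`. -/
theorem QR_symm : QRᵀ = QR := by
  show (Qq.map (Rat.cast : ℚ → ℝ))ᵀ = _
  rw [← map_transpose', Qq_transpose]; rfl

/-- `Q − ε1 = (Q5 − ε1)` reindexed by `e5` (cast). -/
theorem QR_sub_eq : QR - eps • (1 : Matrix (Fin 3 ⊕ Fin 2) (Fin 3 ⊕ Fin 2) ℝ)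
    = ((Q5 - epsQ • (1 : Matrix (Fin 5) (Fin 5) ℚ)).map (Rat.cast : ℚ → ℝ)).submatrix e5 e5 := by
  ext i j
  by_cases h : i = j
  · subst h; simp [QR, Qq, eps]
  · have h' : e5 i ≠ e5 j := fun he => h (e5.injective he)
    simp [QR, Qq, eps, h, h']

/-- **`Q − ε1 ⪰ 0`** (integer Gram certificate `gramQ`). -/
theorem QR_ge : (QR - eps • (1 : Matrix (Fin 3 ⊕ Fin 2) (Fin 3 ⊕ Fin 2) ℝ)).PosSemidef := by
  rw [QR_sub_eq]
  exact (Matrix.posSemidef_submatrix_equiv e5).2 (gramQ.posSemidef_of_smul cQ_pos gramQ_smul)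

/-- `ε > 0`. -/
theorem eps_pos : 0 < eps := by unfold eps; exact_mod_cast epsQ_pos

/-- `K ≥ 0`. -/
theorem KR_nonneg : ∀ k, 0 ≤ KR k := fun k => by unfold KR; exact_mod_cast Kq_nonneg k

/-- `H > 0`. -/
theorem HR_pos : ∀ k, 0 < HR k := fun k => by unfold HR; exact_mod_cast Hq_pos k

/-- The LMI matrix of (QKH) for `sys` and `(Q, K, H)` IS the cast of `LMIq`. -/
theorem lmi_eq :
    -(Matrix.fromBlocks (sys.Aᵀ * QR + QR * sys.A)
        (QR * sys.B - sys.Cᵀ * Matrix.diagonal HR - (Matrix.diagonal KR * sys.C * sys.A)ᵀ)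
        (QR * sys.B - sys.Cᵀ * Matrix.diagonal HR - (Matrix.diagonal KR * sys.C * sys.A)ᵀ)ᵀ
        (-(2 : ℝ) • Matrix.diagonal HR))
      = LMIq.map (Rat.cast : ℚ → ℝ) := by
  have hH : Matrix.diagonal HR = (Matrix.diagonal Hq).map (Rat.cast : ℚ → ℝ) := by rw [map_diagonal']; rfl
  have hK : Matrix.diagonal KR = (Matrix.diagonal Kq).map (Rat.cast : ℚ → ℝ) := by rw [map_diagonal']; rfl
  rw [sys_A, sys_B, sys_C, hH, hK, QR, LMIq, Rq]
  simp only [map_neg', map_fromBlocks', map_add', map_sub', map_mul', map_transpose', map_smul_two']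

/-- **The LMI (QKH) holds** (integer Gram certificate `gramL`, 11×11, reindexed by `e11`). -/
theorem lmi_psd :
    (-(Matrix.fromBlocks (sys.Aᵀ * QR + QR * sys.A)
        (QR * sys.B - sys.Cᵀ * Matrix.diagonal HR - (Matrix.diagonal KR * sys.C * sys.A)ᵀ)
        (QR * sys.B - sys.Cᵀ * Matrix.diagonal HR - (Matrix.diagonal KR * sys.C * sys.A)ᵀ)ᵀ
        (-(2 : ℝ) • Matrix.diagonal HR))).PosSemidef := by
  rw [lmi_eq]
  have h := gramL.posSemidef_of_smul (R := ℝ) cL_pos (Aq := LMIq.submatrix e11.symm e11.symm) gramL_smul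
  have e : (LMIq.submatrix ⇑e11.symm ⇑e11.symm).map (Rat.cast : ℚ → ℝ)
      = (LMIq.map (Rat.cast : ℚ → ℝ)).submatrix e11.symm e11.symm := rfl
  rw [e] at h
  exact (Matrix.posSemidef_submatrix_equiv e11.symm).1 h

/-- **THE CLOSED-FORM LFF CERTIFICATE OF «WSCC9-postB-L-SPdamp» (non-uniform damping) IS A MEMBER OF THE
FAMILY** on Pai's machine-reference space. [cite: VuTuritsyn2016, §III eq. (QKH)] -/
def cert : Certificate sys where
  Q := QR
  kK := KR
  h := HR
  ε := eps
  Q_symm := QR_symm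
  ε_pos := eps_pos
  Q_ge := QR_ge
  kK_nonneg := KR_nonneg
  h_pos := HR_pos
  lmi := lmi_psd


/-! ### The bridge: the undirected presentation has model-1's (directed) vector field -/

/-- The line nonlinearity as a function of machine angles `θ` and relative states `u` (`u₀ = 0`):
`G(p,q) = sin(θ_p − θ_q + (u_p − u_q)) − sin(θ_p − θ_q)` (bookkeeping). -/
def Gfun (θ u : Fin 3 → ℝ) (p q : Fin 3) : ℝ := Real.sin (θ p - θ q + (u p - u q)) - Real.sin (θ p - θ q)

/-- `G(q,p) = −G(p,q)`. -/
theorem Gfun_swap (θ u : Fin 3 → ℝ) (p q : Fin 3) : Gfun θ u q p = -Gfun θ u p q := by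
  unfold Gfun
  have h1 : θ q - θ p + (u q - u p) = -(θ p - θ q + (u p - u q)) := by ring
  have h2 : θ q - θ p = -(θ p - θ q) := by ring
  rw [h1, h2, Real.sin_neg, Real.sin_neg]; ring

/-- `θ_pq = 0` for the lossless data (`G_pq = 0` off the diagonal, `B_pp = 0` on it). -/
theorem θpol_zero (p q : Fin 3) : data.toModel.θpol p q = 0 := by
  unfold ClassicalSwing.θpol
  by_cases h : p = q
  · subst h
    have hB : data.toModel.B p p = 0 := by show ((data.B p p : ℚ) : ℝ) = 0; rw [data_B_self p]; push_cast; rfl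
    rw [hB, div_zero, Real.arctan_zero]
  · have hG : data.toModel.G p q = 0 := by show ((data.G p q : ℚ) : ℝ) = 0; rw [data_G_off p q h]; push_cast; rfl
    rw [hG, zero_div, Real.arctan_zero]

/-- The directed channel weight is the coupling: `E_pE_qY_pq = C_pq` off the diagonal, `0` on it. -/
theorem channelWeight_eq (k : Fin 3 × Fin 3) :
    data.toModel.toLitNode.channelWeight data.toModel.Ypol k = if k.1 = k.2 then 0 else (data.Cc k.1 k.2 : ℝ) := by
  unfold InternalNode.channelWeight
  by_cases h : k.1 = k.2
  · simp [h]
  · rw [if_neg h, if_neg h]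
    have hBpos : (0 : ℝ) < data.toModel.B k.1 k.2 := by
      show (0 : ℝ) < (data.B k.1 k.2 : ℝ); exact_mod_cast data_B_pos k.1 k.2 h
    have hG : data.toModel.G k.1 k.2 = 0 := by
      show ((data.G k.1 k.2 : ℚ) : ℝ) = 0; rw [data_G_off k.1 k.2 h]; push_cast; rfl
    have hY : data.toModel.Ypol k.1 k.2 = data.toModel.B k.1 k.2 := by
      unfold ClassicalSwing.Ypol
      rw [hG]; simp [Real.sqrt_sq hBpos.le]
    rw [hY]
    show data.toModel.E k.1 * data.toModel.E k.2 * data.toModel.B k.1 k.2 = (data.Cc k.1 k.2 : ℝ)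
    simp only [RecastData.toModel, RecastData.Cc]; push_cast; ring

/-- The nonlinearity of `sys` is `G` on the line's end machines. -/
theorem sys_nonlin (y : Fin 3 ⊕ Fin 2 → ℝ) (k : RecastData.LffPair 2) :
    sys.nonlin y k = Gfun data.angleOf (Fin.cases 0 (y ∘ Sum.inr)) k.1.1 k.1.2 := by
  unfold sys
  rw [System.machineReference_nonlin]
  simp only [RecastData.lffδso, RecastData.lffδs, RecastData.lffEo_mulVec, RecastData.lffE_mulVec, Gfun]

/-- The nonlinearity of model-1's directed system is the same `G` (`θ = 0`). -/
theorem dir_nonlin (y : Fin 3 ⊕ Fin 2 → ℝ) (k : Fin 3 × Fin 3) :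
    (data.lurieSystem data.angleOf).nonlin y k = Gfun data.angleOf (Fin.cases 0 (y ∘ Sum.inr)) k.1 k.2 := by
  unfold RecastData.lurieSystem InternalNode.toMachineReference
  rw [System.machineReference_nonlin]
  simp only [InternalNode.channelShift, θpol_zero, add_zero, InternalNode.pairIncidence_mulVec, Gfun]
  rfl

/-- `C` is symmetric on the data (`B` symmetric): `C_qp = C_pq`. -/
theorem data_Cc_symm : ∀ p q : Fin 3, data.Cc q p = data.Cc p q := by decide +kernel

/-- **The undirected line sum equals the directed sum out of machine `i`** (antisymmetry of `G`, symmetry of `C`,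
`E_pE_qY_pq = C_pq`): the heart of the bridge. -/
theorem lineSum_eq (u : Fin 3 → ℝ) (i : Fin 3) :
    ∑ k : RecastData.LffPair 2, Bω i k * Gfun data.angleOf u k.1.1 k.1.2
      = ∑ k : Fin 3 × Fin 3, System.directedInput (fun i => 1 / data.toModel.toLitNode.M i) Prod.fst
          (data.toModel.toLitNode.channelWeight data.toModel.Ypol) i k * Gfun data.angleOf u k.1 k.2 := by
  set g : Fin 3 × Fin 3 → ℝ := fun kk =>
    (data.Cc kk.1 kk.2 : ℝ) / 2 * (((if i = kk.1 then (1 : ℝ) else 0) - (if i = kk.2 then (1 : ℝ) else 0))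
      / (data.M i : ℝ)) * Gfun data.angleOf u kk.1 kk.2 with hg
  have hsub : ∑ k : RecastData.LffPair 2, Bω i k * Gfun data.angleOf u k.1.1 k.1.2
      = ∑ kk : Fin 3 × Fin 3, if kk.1 ≠ kk.2 then g kk else 0 := by
    rw [← Finset.sum_filter, Finset.sum_subtype (Finset.univ.filter (fun kk : Fin 3 × Fin 3 => kk.1 ≠ kk.2))
      (p := fun kk : Fin 3 × Fin 3 => kk.1 ≠ kk.2) (fun kk => by simp) g]
    rfl
  rw [hsub]
  simp only [hg, System.directedInput, Matrix.of_apply, channelWeight_eq, ClassicalSwing.toLitNode_M]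
  have c10 := data_Cc_symm 0 1
  have c20 := data_Cc_symm 0 2
  have c21 := data_Cc_symm 1 2
  have g10 := Gfun_swap data.angleOf u 0 1
  have g20 := Gfun_swap data.angleOf u 0 2
  have g21 := Gfun_swap data.angleOf u 1 2
  fin_cases i <;>
    simp [Fintype.sum_prod_type, Fin.sum_univ_three, c10, c20, c21, g10, g20, g21, RecastData.toModel] <;> ring

/-- **The undirected and the directed machine-reference presentations have the same vector field.** -/
theorem field_eq (y : Fin 3 ⊕ Fin 2 → ℝ) : sys.field y = (data.lurieSystem data.angleOf).field y := by
  funext j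
  rcases j with i | a
  · have hL : sys.field y (Sum.inl i) = -(data.toModel.toLitNode.D i / data.toModel.toLitNode.M i) * y (Sum.inl i)
        - ∑ k : RecastData.LffPair 2, Bω i k * Gfun data.angleOf (fun j => Fin.cases 0 (y ∘ Sum.inr) j) k.1.1 k.1.2 := by
      unfold sys
      rw [System.machineReference_field_inl]
      simp only [← sys_nonlin]; rfl
    have hR : (data.lurieSystem data.angleOf).field y (Sum.inl i)
        = -(data.toModel.toLitNode.D i / data.toModel.toLitNode.M i) * y (Sum.inl i)
        - ∑ k : Fin 3 × Fin 3, System.directedInput (fun i => 1 / data.toModel.toLitNode.M i) Prod.fst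
            (data.toModel.toLitNode.channelWeight data.toModel.Ypol) i k
            * Gfun data.angleOf (fun j => Fin.cases 0 (y ∘ Sum.inr) j) k.1 k.2 := by
      unfold RecastData.lurieSystem InternalNode.toMachineReference
      rw [System.machineReference_field_inl]
      simp only [← dir_nonlin]; rfl
    rw [hL, hR, lineSum_eq]
  · unfold sys RecastData.lurieSystem InternalNode.toMachineReference
    rw [System.machineReference_field_inr, System.machineReference_field_inr]

/-- **HYPOTHESIS-FREE BRIDGE.** Along EVERY solution of model-1's typed classical model `data.toModel`
(lossless post-B network, damping `D_SP`, injections `P′`) the machine-reference state `(ω | σ)` solves `sys`.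
[cite: Pai1981, §3.6.3 eq. (3.45)] -/
theorem hasDerivWithinAt_state {c : ℝ → ClassicalSwing.State 3} (hc : data.toModel.IsSolutionOn c univ)
    {s : Set ℝ} (t : ℝ) :
    HasDerivWithinAt (fun τ => data.lurieState data.angleOf (c τ))
      (sys.field (data.lurieState data.angleOf (c t))) s t := by
  rw [field_eq]
  exact data.hasDerivWithinAt_lurieState data_B_pos data_eqData hc t

end Summit.Ventures.GridStability.Lyapunov.WSCC9LffNU

end
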